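import Literature.Analysis.Complex.ArcGreenHalfPlane
import Literature.Analysis.Complex.HarnackHalfPlane
import HarnessLib

/-!
# The Green function of an arc crossing a cone-annulus: uniform bounds

The configuration of the single-scale harmonic-measure estimate behind [LSW] Lemma 6.3: a Jordan
arc `L` (`e : [0,1] ≃ₜ L`) lying in the closed cone-annulus

  `{r₁ ≤ ‖z‖ ≤ r₂} ∩ {|re z| ≤ c · im z}`   (`0 < r₁ < r₂`)

with its initial point on the outer circle, `‖e 0‖ = r₂`, and its final point on the inner one,
`‖e 1‖ = r₁`. For the Green function `g = arcGreen e` of `ℂ ∖ L` and its reflected difference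
`q(w) = g(w̄) - g(w)` (`ArcGreenHalfPlane`: `q ≥ 0` on `im ≥ 0`) we prove bounds UNIFORM in the
arc (depending only on `c, r₁, r₂`):

* elementary geometry of the configuration: `im z ≥ r₁/√(1+c²)` on `L` (`im_ge_of_mem_cone`),
  `L ⊆ B̄(a, 2r₂)`, `‖b - a‖ ≥ r₂ - r₁`, and `g(w) ≤ max (log 2) (log (16‖w - a‖/(r₂ - r₁)))`;
* `arcGreen_conj_sub_le_mul_im` — **`q(w) ≤ K · im w` on `im w ≥ 0`** with
  `K = max (log 2) (log (32 r₂/(r₂ - r₁))) · √(1+c²)/r₁`: minimum principle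
  (`harmonic_ge_of_frontier_of_cocompact`) for the harmonic `K im - q` on `ℍ ∖ L`, which is `≥ 0`
  on `ℝ`, at `∞`, and on `L` (there `q = g(z̄) ≤ max (log 2) (log (32r₂/(r₂-r₁)))` as
  `‖z̄ - a‖ ≤ 2r₂`, while `im z ≥ r₁/√(1+c²)`);
* `harnack_chain_of_local_im` — a Harnack chain (`Complex.im_apply_ge_third`) for functions that
  are LOCALLY imaginary parts of `ℍ`-valued holomorphic maps;
* `le_arcGreen_of_im_nonpos` — **uniform lower bound on and below the real axis**:
  `g(p) ≥ log 2 / 3^N` for `im p ≤ 0`, `‖p‖ ≤ r₂`, `N = ⌈24 r₂ √(1+c²)/r₁⌉₊` (far lower bound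
  `le_arcGreen_of_far` at `a - 4r₂ i` and a Harnack chain in the half-plane
  `{im < r₁/(2√(1+c²))}`, where `g = im(-iΛ)` on discs).
-/

noncomputable section

open Set Filter Metric Topology Function Complex Bornology InnerProductSpace
open scoped unitInterval ComplexConjugate

namespace Literature.Analysis.Complex

/-! ### A Harnack chain for locally represented positive harmonic functions -/

/-- **Harnack chain, local form.** Let `u : ℂ → ℝ` be, on each disc `B(z, δ)` about the points
of the segment `[p, p']`, the imaginary part of a holomorphic map, and positive there.
If `‖p' - p‖ ≤ n δ/2` then `u(p') ≥ u(p)/3ⁿ`. [folklore] -/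
theorem harnack_chain_of_local_im {u : ℂ → ℝ} {p p' : ℂ} {δ : ℝ} (hδ : 0 < δ)
    (hloc : ∀ z ∈ segment ℝ p p', ∃ Q : ℂ → ℂ, DifferentiableOn ℂ Q (ball z δ) ∧
      (∀ w ∈ ball z δ, (Q w).im = u w) ∧ ∀ w ∈ ball z δ, 0 < u w)
    {n : ℕ} (hn : ‖p' - p‖ ≤ n * (δ / 2)) : u p / 3 ^ n ≤ u p' := by
  rcases Nat.eq_zero_or_pos n with rfl | hnpos
  · have : p' = p := by
      have h : ‖p' - p‖ ≤ 0 := by simpa using hn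
      exact sub_eq_zero.1 (norm_le_zero_iff.1 h)
    subst this
    simp
  set v : ℂ := ((n : ℝ)⁻¹ : ℂ) * (p' - p) with hv
  have hvn : ‖v‖ ≤ δ / 2 := by
    rw [hv, norm_mul, norm_inv, Complex.norm_real, Real.norm_eq_abs, abs_of_pos (by positivity),
      inv_mul_le_iff₀ (by positivity)]
    linarith
  set P : ℕ → ℂ := fun k ↦ p + (k : ℂ) * v with hP
  have hP0 : P 0 = p := by simp [hP]
  have hPn : P n = p' := by
    simp only [hP, hv]
    have hn0 : ((n : ℝ) : ℂ) ≠ 0 := by exact_mod_cast hnpos.ne'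
    field_simp
    push_cast
    field_simp
    ring
  have hPseg : ∀ k, k ≤ n → P k ∈ segment ℝ p p' := by
    intro k hk
    rw [segment_eq_image']
    refine ⟨(k : ℝ) / n, ⟨by positivity, ?_⟩, ?_⟩
    · rw [div_le_one (by exact_mod_cast hnpos)]; exact_mod_cast hk
    · simp only [hP, hv]
      push_cast
      rw [div_eq_mul_inv]
      simp only [Complex.real_smul]
      push_cast
      ring
  have hstep : ∀ k, k < n → u (P k) / 3 ≤ u (P (k + 1)) := by
    intro k hk
    obtain ⟨Q, hQd, hQim, hpos⟩ := hloc _ (hPseg k hk.le)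
    have hpos' : ∀ w ∈ ball (P k) δ, 0 < (Q w).im := fun w hw ↦ by rw [hQim w hw]; exact hpos w hw
    have hdist : ‖P (k + 1) - P k‖ ≤ δ / 2 := by
      have : P (k + 1) - P k = v := by simp only [hP]; push_cast; ring
      rw [this]; exact hvn
    have h := Complex.im_apply_ge_third hδ hQd hpos' hdist
    rwa [hQim _ (mem_ball_self hδ), hQim _ (by rw [mem_ball, dist_eq_norm]; linarith)] at h
  have hind : ∀ k, k ≤ n → u p / 3 ^ k ≤ u (P k) := by
    intro k
    induction k with
    | zero => intro _; simp [hP0]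
    | succ k ih =>
      intro hk
      have h1 := ih (Nat.le_of_succ_le hk)
      have h2 := hstep k (Nat.lt_of_succ_le hk)
      calc u p / 3 ^ (k + 1) = (u p / 3 ^ k) / 3 := by rw [pow_succ]; ring
        _ ≤ u (P k) / 3 := by gcongr
        _ ≤ u (P (k + 1)) := h2
  simpa [hPn] using hind n le_rfl

/-! ### The cone-annulus configuration -/

section Cone

variable {L : Set ℂ} (e : I ≃ₜ L) {c r₁ r₂ : ℝ}

/-- In the cone `{|re z| ≤ c im z}`, `‖z‖ ≤ √(1+c²) im z`; so in the cone-annulus the points of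
the arc have height at least `r₁/√(1+c²)`. [folklore] -/
theorem im_ge_of_mem_cone (hc : 0 < c)
    (hL : ∀ z ∈ L, r₁ ≤ ‖z‖ ∧ ‖z‖ ≤ r₂ ∧ |z.re| ≤ c * z.im) {z : ℂ} (hz : z ∈ L) :
    r₁ / Real.sqrt (1 + c ^ 2) ≤ z.im := by
  obtain ⟨h1, -, h3⟩ := hL z hz
  have hs : 0 < Real.sqrt (1 + c ^ 2) := Real.sqrt_pos.2 (by positivity)
  have hsq : ‖z‖ ^ 2 = z.re ^ 2 + z.im ^ 2 := by rw [Complex.sq_norm, Complex.normSq_apply]; ring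
  have h4 : z.re ^ 2 ≤ (c * z.im) ^ 2 := by
    have : |z.re| ^ 2 ≤ (c * z.im) ^ 2 := pow_le_pow_left₀ (abs_nonneg _) h3 2
    rwa [sq_abs] at this
  have h5 : ‖z‖ ^ 2 ≤ (1 + c ^ 2) * z.im ^ 2 := by nlinarith
  have him : 0 ≤ z.im := by
    by_contra h
    push Not at h
    have : c * z.im < 0 := mul_neg_of_pos_of_neg hc h
    linarith [abs_nonneg z.re]
  have h6 : ‖z‖ ≤ Real.sqrt (1 + c ^ 2) * z.im := by
    have := (Real.le_sqrt (norm_nonneg z) (by positivity)).2 h5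
    rwa [Real.sqrt_mul (by positivity), Real.sqrt_sq him] at this
  rw [div_le_iff₀ hs]
  linarith

/-- Points of the arc lie in the open upper half-plane. [folklore] -/
theorem im_pos_of_mem_cone (hc : 0 < c) (hr₁ : 0 < r₁)
    (hL : ∀ z ∈ L, r₁ ≤ ‖z‖ ∧ ‖z‖ ≤ r₂ ∧ |z.re| ≤ c * z.im) {z : ℂ} (hz : z ∈ L) : 0 < z.im :=
  lt_of_lt_of_le (div_pos hr₁ (Real.sqrt_pos.2 (by positivity))) (im_ge_of_mem_cone hc hL hz)

/-- The arc lies in the closed disc of radius `2r₂` about its initial point. [folklore] -/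
theorem subset_closedBall_endpoint (hL : ∀ z ∈ L, r₁ ≤ ‖z‖ ∧ ‖z‖ ≤ r₂ ∧ |z.re| ≤ c * z.im)
    (ha : ‖((e 0 : L) : ℂ)‖ = r₂) : L ⊆ closedBall ((e 0 : L) : ℂ) (2 * r₂) := fun z hz ↦ by
  rw [mem_closedBall, dist_eq_norm]
  calc ‖z - ((e 0 : L) : ℂ)‖ ≤ ‖z‖ + ‖((e 0 : L) : ℂ)‖ := norm_sub_le _ _
    _ ≤ r₂ + r₂ := add_le_add (hL z hz).2.1 ha.le
    _ = 2 * r₂ := by ring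

/-- The endpoints are at least `r₂ - r₁` apart. [folklore] -/
theorem sub_le_norm_endpoints (ha : ‖((e 0 : L) : ℂ)‖ = r₂) (hb : ‖((e 1 : L) : ℂ)‖ = r₁) :
    r₂ - r₁ ≤ ‖((e 1 : L) : ℂ) - ((e 0 : L) : ℂ)‖ := by
  have := norm_sub_norm_le ((e 0 : L) : ℂ) ((e 1 : L) : ℂ)
  rw [ha, hb, norm_sub_rev] at this
  linarith

/-- **Uniform upper bound** for the Green function in terms of the distance from the initial
point: `g(w) ≤ max (log 2) (log (16 ‖w - a‖/(r₂ - r₁)))`. [folklore] -/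
theorem arcGreen_le_max_log_of_cone (hr₁₂ : r₁ < r₂) (ha : ‖((e 0 : L) : ℂ)‖ = r₂)
    (hb : ‖((e 1 : L) : ℂ)‖ = r₁) {w : ℂ} (hw : w ∉ L) :
    arcGreen e w ≤ max (Real.log 2) (Real.log (16 * ‖w - ((e 0 : L) : ℂ)‖ / (r₂ - r₁))) := by
  have h := arcGreen_le_max_log e hw
  have hwa : 0 < ‖w - ((e 0 : L) : ℂ)‖ := norm_pos_iff.2 (sub_ne_zero.2 fun h' ↦ hw (h' ▸ (e 0).2))
  have hba : 0 < ‖((e 1 : L) : ℂ) - ((e 0 : L) : ℂ)‖ :=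
    norm_pos_iff.2 (sub_ne_zero.2 (arc_endpoints_ne e).symm)
  refine h.trans (max_le_max le_rfl (Real.log_le_log (by positivity) ?_))
  exact div_le_div_of_nonneg_left (by positivity) (by linarith) (sub_le_norm_endpoints e ha hb)

/-! ### `q ≤ K im` on the closed upper half-plane -/

/-- The imaginary part is harmonic. [folklore] -/
theorem harmonicAt_im (w : ℂ) : HarmonicAt (fun z : ℂ ↦ z.im) w :=
  (analyticAt_id (𝕜 := ℂ) (z := w)).harmonicAt_im

/-- **`q(w) ≤ K · im w` on the closed upper half-plane**, with
`K = max (log 2) (log (32 r₂/(r₂ - r₁))) · √(1+c²)/r₁`: the harmonic function `K im - q` on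
`ℍ ∖ L` is `≥ 0` on `ℝ`, at `∞` (lim inf), and on `L`, where `q = g(z̄) ≤ max (log 2)
(log (32r₂/(r₂-r₁)))` (`‖z̄ - a‖ ≤ 2r₂`) while `im z ≥ r₁/√(1+c²)`; minimum principle.
[folklore] -/
theorem arcGreen_conj_sub_le_mul_im (hc : 0 < c) (hr₁ : 0 < r₁) (hr₁₂ : r₁ < r₂)
    (hL : ∀ z ∈ L, r₁ ≤ ‖z‖ ∧ ‖z‖ ≤ r₂ ∧ |z.re| ≤ c * z.im)
    (ha : ‖((e 0 : L) : ℂ)‖ = r₂) (hb : ‖((e 1 : L) : ℂ)‖ = r₁) {w : ℂ} (hw : 0 ≤ w.im) :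
    arcGreen e (conj w) - arcGreen e w ≤
      max (Real.log 2) (Real.log (32 * r₂ / (r₂ - r₁))) * Real.sqrt (1 + c ^ 2) / r₁ * w.im := by
  set a : ℂ := ((e 0 : L) : ℂ) with hadef
  set K₀ : ℝ := max (Real.log 2) (Real.log (32 * r₂ / (r₂ - r₁))) with hK₀
  set hgt : ℝ := r₁ / Real.sqrt (1 + c ^ 2) with hhgt
  set K : ℝ := K₀ * Real.sqrt (1 + c ^ 2) / r₁ with hK
  have hs : 0 < Real.sqrt (1 + c ^ 2) := Real.sqrt_pos.2 (by positivity)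
  have hK₀pos : 0 < K₀ := lt_of_lt_of_le (Real.log_pos (by norm_num)) (le_max_left _ _)
  have hKpos : 0 < K := by rw [hK]; positivity
  have hKhgt : K * hgt = K₀ := by rw [hK, hhgt]; field_simp
  have hLc : IsCompact L := isCompact_arc e
  have hLH : ∀ z ∈ L, 0 < z.im := fun z hz ↦ im_pos_of_mem_cone hc hr₁ hL hz
  have hconjL : ∀ z : ℂ, 0 ≤ z.im → conj z ∉ L := fun z hz h ↦ by
    have := hLH _ h; rw [Complex.conj_im] at this; linarith
  -- the bound on `L`
  have honL : ∀ z ∈ L, arcGreen e (conj z) - arcGreen e z ≤ K * z.im := by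
    intro z hz
    have hzc : conj z ∉ L := hconjL z (hLH z hz).le
    have h1 : arcGreen e (conj z) ≤ K₀ := by
      refine (arcGreen_le_max_log_of_cone e hr₁₂ ha hb hzc).trans (max_le_max le_rfl ?_)
      have hza : 0 < ‖conj z - a‖ := norm_pos_iff.2 (sub_ne_zero.2 fun h' ↦ hzc (h' ▸ (e 0).2))
      refine Real.log_le_log (by positivity) ?_
      have : ‖conj z - a‖ ≤ 2 * r₂ :=
        calc ‖conj z - a‖ ≤ ‖conj z‖ + ‖a‖ := norm_sub_le _ _
          _ ≤ r₂ + r₂ := add_le_add (by rw [Complex.norm_conj]; exact (hL z hz).2.1) ha.le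
          _ = 2 * r₂ := by ring
      rw [div_le_div_iff_of_pos_right (by linarith)]
      linarith
    rw [arcGreen_of_mem e hz, sub_zero]
    calc arcGreen e (conj z) ≤ K₀ := h1
      _ = K * hgt := hKhgt.symm
      _ ≤ K * z.im := by gcongr; exact im_ge_of_mem_cone hc hL hz
  -- cases: real, on the arc, or in `U = ℍ ∖ L`
  change arcGreen e (conj w) - arcGreen e w ≤ K * w.im
  rcases hw.eq_or_lt with him | him
  · rw [arcGreen_conj_sub_of_im_eq_zero e him.symm, ← him, mul_zero]
  by_cases hwL : w ∈ L
  · exact honL w hwL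
  set U : Set ℂ := {z : ℂ | 0 < z.im} \ L with hU
  set f : ℂ → ℝ := fun z ↦ K * z.im - (arcGreen e (conj z) - arcGreen e z) with hf
  have hUo : IsOpen U := (isOpen_lt continuous_const Complex.continuous_im).sdiff hLc.isClosed
  have hUc : IsPreconnected U :=
    isPreconnected_upperHalfPlane_diff hLc hLH
      (Literature.Topology.PlaneTopology.JordanArcSeparation_holds L ⟨e⟩).isPreconnected
  have hharm : HarmonicOnNhd f U := by
    intro z hz
    have h := ((harmonicAt_im z).const_smul (c := K)).sub
      ((harmonicAt_arcGreen_conj e (hconjL z hz.1.le)).sub (harmonicAt_arcGreen e hz.2))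
    exact h
  have hfc : Continuous f :=
    (continuous_const.mul Complex.continuous_im).sub (continuous_arcGreen_conj_sub e)
  have hfront : ∀ ζ ∈ frontier U, 0 ≤ f ζ := by
    intro ζ hζ
    have hζ' : ζ.im = 0 ∨ ζ ∈ L := by
      rw [hU, Set.sdiff_eq] at hζ
      have h := frontier_inter_subset _ _ hζ
      rw [Complex.frontier_setOf_lt_im, frontier_compl] at h
      rcases h with ⟨h, -⟩ | ⟨-, h⟩
      · exact Or.inl h
      · exact Or.inr (hLc.isClosed.frontier_subset h)
    rcases hζ' with h | h
    · rw [hf]; dsimp only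
      rw [arcGreen_conj_sub_of_im_eq_zero e h, h, mul_zero, sub_zero]
    · rw [hf]; dsimp only
      linarith [honL ζ h]
  have hbdry : ∀ ζ ∈ frontier U, ∀ ε : ℝ, 0 < ε → ∀ᶠ z in 𝓝[U] ζ, 0 - ε ≤ f z := by
    intro ζ hζ ε hε
    have h1 : ∀ᶠ z in 𝓝 ζ, f ζ - ε < f z :=
      (hfc.continuousAt (x := ζ)).eventually (Ioi_mem_nhds (by linarith))
    refine (h1.filter_mono nhdsWithin_le_nhds).mono fun z hz ↦ ?_
    linarith [hfront ζ hζ]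
  have hinf : ∀ ε : ℝ, 0 < ε → ∀ᶠ z in cocompact ℂ ⊓ 𝓟 U, 0 - ε ≤ f z := by
    intro ε hε
    have h1 := tendsto_arcGreen_conj_sub e
    rw [cobounded_eq_cocompact, Metric.tendsto_nhds] at h1
    rw [Filter.eventually_inf_principal]
    refine (h1 ε hε).mono fun z hz hzU ↦ ?_
    rw [dist_zero_right, Real.norm_eq_abs, abs_lt] at hz
    rw [hf]; dsimp only
    have : 0 ≤ K * z.im := mul_nonneg hKpos.le hzU.1.le
    linarith [hz.2]
  have h := harmonic_ge_of_frontier_of_cocompact hUo hUc hharm hbdry hinf w ⟨him, hwL⟩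
  rw [hf] at h; dsimp only at h
  linarith

/-! ### A uniform lower bound for the Green function below the real axis -/

/-- **Uniform lower bound on and below the real axis**: for `im p ≤ 0` and `‖p‖ ≤ r₂`,
`g(p) ≥ log 2 / 3^N`, `N = ⌈24 r₂ √(1+c²)/r₁⌉₊`: the far lower bound `g ≥ log 2` at
`a - 4r₂ i` (`le_arcGreen_of_far`) propagated by a Harnack chain (`harnack_chain_of_local_im`,
`g = im(-iΛ)` on discs of radius `r₁/(2√(1+c²))`, which miss `L`). [folklore] -/
theorem le_arcGreen_of_im_nonpos (hc : 0 < c) (hr₁ : 0 < r₁) (hr₁₂ : r₁ < r₂)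
    (hL : ∀ z ∈ L, r₁ ≤ ‖z‖ ∧ ‖z‖ ≤ r₂ ∧ |z.re| ≤ c * z.im)
    (ha : ‖((e 0 : L) : ℂ)‖ = r₂) {p : ℂ} (hp : p.im ≤ 0) (hpn : ‖p‖ ≤ r₂) :
    Real.log 2 / 3 ^ ⌈24 * r₂ * Real.sqrt (1 + c ^ 2) / r₁⌉₊ ≤ arcGreen e p := by
  set a : ℂ := ((e 0 : L) : ℂ) with hadef
  set hgt : ℝ := r₁ / Real.sqrt (1 + c ^ 2) with hhgt
  set δ : ℝ := hgt / 2 with hδ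
  have hs : 0 < Real.sqrt (1 + c ^ 2) := Real.sqrt_pos.2 (by positivity)
  have hhgtpos : 0 < hgt := by rw [hhgt]; positivity
  have hδpos : 0 < δ := by rw [hδ]; positivity
  have hr₂ : 0 < r₂ := hr₁.trans hr₁₂
  have haim : a.im ≤ r₂ := by
    have := Complex.abs_im_le_norm a; rw [ha] at this; exact (abs_le.1 this).2
  -- the far point
  set pf : ℂ := a - ((4 * r₂ : ℝ) : ℂ) * Complex.I with hpf
  have hpfa : ‖pf - a‖ = 4 * r₂ := by
    rw [hpf, sub_sub_cancel_left, norm_neg, norm_mul, Complex.norm_real, Complex.norm_I, mul_one,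
      Real.norm_eq_abs, abs_of_pos (by positivity)]
  have hpfim : pf.im ≤ 0 := by
    rw [hpf]; simp; linarith
  have hfar : Real.log 2 ≤ arcGreen e pf :=
    le_arcGreen_of_far e (R := 2 * r₂) (by positivity) (subset_closedBall_endpoint e hL ha)
      (by rw [hpfa]; linarith)
  -- the chain from `pf` to `p`
  have hballL : ∀ z : ℂ, z.im ≤ 0 → ball z δ ⊆ Lᶜ := by
    intro z hz w hw hwL
    have h1 : r₁ / Real.sqrt (1 + c ^ 2) ≤ w.im := im_ge_of_mem_cone hc hL hwL
    have h2 : w.im < z.im + δ := by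
      rw [mem_ball, dist_eq_norm] at hw
      have := Complex.abs_im_le_norm (w - z)
      rw [Complex.sub_im] at this
      linarith [(abs_lt.1 (lt_of_le_of_lt this hw)).2]
    rw [← hhgt] at h1
    have : hgt = 2 * δ := by rw [hδ]; ring
    linarith
  have hloc : ∀ z ∈ segment ℝ pf p, ∃ Q : ℂ → ℂ, DifferentiableOn ℂ Q (ball z δ) ∧
      (∀ w ∈ ball z δ, (Q w).im = arcGreen e w) ∧ ∀ w ∈ ball z δ, 0 < arcGreen e w := by
    intro z hz
    have hzim : z.im ≤ 0 := by
      have hconv : Convex ℝ {z : ℂ | z.im ≤ 0} := convex_halfSpace_im_le 0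
      exact hconv.segment_subset hpfim hp hz
    have hball := hballL z hzim
    obtain ⟨Λ, hΛd, -, hΛg⟩ := exists_log_arcGreenMap_ball e hball
    refine ⟨fun w ↦ -Complex.I * Λ w, hΛd.const_mul _, fun w hw ↦ ?_, fun w hw ↦ arcGreen_pos e (hball hw)⟩
    rw [hΛg w hw]
    simp
  set n : ℕ := ⌈24 * r₂ * Real.sqrt (1 + c ^ 2) / r₁⌉₊ with hn
  have hdist : ‖p - pf‖ ≤ n * (δ / 2) := by
    have h1 : ‖p - pf‖ ≤ 6 * r₂ := by
      calc ‖p - pf‖ ≤ ‖p‖ + ‖pf‖ := norm_sub_le _ _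
        _ ≤ r₂ + (‖a‖ + ‖((4 * r₂ : ℝ) : ℂ) * Complex.I‖) := by
            gcongr
            exact norm_sub_le _ _
        _ = r₂ + (r₂ + 4 * r₂) := by
            rw [ha, norm_mul, Complex.norm_real, Complex.norm_I, mul_one, Real.norm_eq_abs,
              abs_of_pos (by positivity)]
        _ = 6 * r₂ := by ring
    have h2 : 24 * r₂ * Real.sqrt (1 + c ^ 2) / r₁ ≤ n := Nat.le_ceil _
    have h3 : (n : ℝ) * (δ / 2) ≥ 6 * r₂ := by
      rw [hδ, hhgt]
      calc (6 : ℝ) * r₂ = 24 * r₂ * Real.sqrt (1 + c ^ 2) / r₁ * (r₁ / Real.sqrt (1 + c ^ 2) / 2 / 2) := by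
            field_simp; ring
        _ ≤ n * (r₁ / Real.sqrt (1 + c ^ 2) / 2 / 2) := by gcongr
    linarith
  have hchain := harnack_chain_of_local_im hδpos hloc hdist
  calc Real.log 2 / 3 ^ n ≤ arcGreen e pf / 3 ^ n := by gcongr
    _ ≤ arcGreen e p := hchain

end Cone

end Literature.Analysis.Complex
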